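import Literature.NumberTheory.GaloisRepresentations.LubinTateColemanCoordUnipotentTwo
import Literature.NumberTheory.GaloisRepresentations.PowerSeriesTopNilpotentAction
import Literature.NumberTheory.GaloisRepresentations.LubinTateColemanResidualLift
import HarnessLib

/-!
# The `𝒪_F⟦T⟧`-module structure on the Coleman coordinates in the Lubin–Tate direction at `q = 2`, `T = σ_γ − 1`:
# `r_{σ_γ^n β} = (1 + T)^n · r_β` (de Shalit I §3.1 "`u^α ↦ (1+S)^α`", §3.4 Lemma (ii))

De Shalit, *Iwasawa theory of elliptic curves with complex multiplication* (1987), Ch. I §3.1 and §3.4 Lemma (ii): the Coleman map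
`i : 𝒰 → Λ(𝒢)` is `ℤ_p⟦𝒢⟧`-linear, and for `p = 2` "`Γ = 1 + 4ℤ₂`", `Λ ≅ ℤ₂⟦S⟧` by `u ↦ 1 + S`.  On the series side at `q = 2` (`π = 2u`,
`f = πX + X²`, coordinates `r_β ∈ 𝒪_F⟦Y⟧` of `LubinTateColemanTraceKernelTwo`, action `r_{σ_v β} = v·ρ_v·(r_β ∘ [v]_f)` of
`LubinTateColemanCoordGaloisTwo`): for a unit `γ ∈ 𝒪_F^× ≅ Gal(K_π^∞/F)` the operator `D_γ r := γ·ρ_γ·(r ∘ [γ]) − r` is `𝒪_F`-linear and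
topologically nilpotent (`twistOp_sub_self_mem_adicFilt_succ`), so (`PowerSeriesTopNilpotentAction`) `𝒪_F⟦T⟧` acts on ALL of `𝒪_F⟦Y⟧`
by `c(T)·r = Σ_k c_k D_γ^k r`, and:

* `twistLinear` — `D_γ` as a linear map, `twistLinear_apply`, `twistLinear_mem_adicFiltGen_succ`;
* `isAdicComplete_LTCoeff` — `𝒪_F` (discrete copy `LTCoeff F`) is `(π)`-adically complete (Mathlib's `IsAdicComplete 𝓂[F] 𝒪[F]`);
* ★★ `unitCoordTwo_unitAct_eq_tAct` — **`r_{σ_γ β} = (1 + T)·r_β`**; ★★ `unitCoordTwo_unitAct_pow_eq_tAct` — **`r_{σ_{γ^n} β} = (1 + T)^n·r_β`**: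
  the coordinate map `β ↦ r_β` intertwines the action of `⟨γ⟩ ⊆ Gal(K_π^∞/F)` on `𝒰` with the `𝒪_F⟦T⟧`-module structure `T = D_γ` on
  `𝒪_F⟦Y⟧` — Theorem I.3.7's `Λ(Γ)`-linearity in the Lubin–Tate direction, series currency.

Everything PROVED (0 sorry, no named facts); one transparent definition (`twistLinear`).  What remains for «`U_v ≅ Λ ⊕ …`» in this direction:
that `𝒪_F⟦Y⟧` is free of rank `2` over `𝒪_F⟦T⟧` under this action (the `Δ = {±1}` part), i.e. `≅ Λ(ℤ₂^×, 𝒪_F)`.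

## References

* E. de Shalit, *Iwasawa theory of elliptic curves with complex multiplication* (1987), Ch. I §3.1, §3.4 Lemma (ii), §3.7. [deShalit1987]
* L. C. Washington, *Introduction to Cyclotomic Fields*, 2nd ed. (1997), §13.2. [Washington1997]
-/

noncomputable section

open scoped PowerSeries.WithPiTopology

namespace Literature.NumberTheory.GaloisRepresentations

section CoordIwasawaActionTwo

open GaloisRepresentations.IsNonarchimedeanLocalField LubinTate ValuativeRel Finset

variable {F : Type} [Field F] [ValuativeRel F] [TopologicalSpace F] [IsNonarchimedeanLocalField F]

attribute [local instance] ltNormUniformSpace ltNormIsUniformAddGroup rk1 nF nE fintypeResidueField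

variable {π : 𝒪[F]} (hπ : (valuation F).IsUniformizer (π : F)) (hq : residueFieldCard F = 2)

include hπ in
/-- **`𝒪_F` is `(π)`-adically complete** (discrete copy `LTCoeff F`; Mathlib's `IsAdicComplete 𝓂[F] 𝒪[F]` with `𝓂 = (π)`).
[cite: deShalit1987, Ch. I §3.10] -/
theorem isAdicComplete_LTCoeff : IsAdicComplete (Ideal.span {LTCoeff.of F π}) (LTCoeff F) :=
  { isHausdorff_LTCoeff hπ, isPrecomplete_LTCoeff hπ with }

/-! ### The twist operator `D_γ r = γ·ρ_γ·(r ∘ [γ]) − r` as a topologically nilpotent linear map -/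

/-- **`D_γ r := γ·ρ_γ·(r ∘ [γ]_f) − r`**, the `𝒪_F`-linear operator `σ_γ − 1` on the coordinate module `𝒪_F⟦Y⟧` (`unitCoordTwo_unitAct`:
`D_γ r_β = r_{σ_γ β} − r_β`). [cite: deShalit1987, Ch. I §3.4 Lemma (ii)] -/
def twistLinear (u : (LTCoeff F)ˣ) (γ : 𝒪[F]ˣ) : PowerSeries (LTCoeff F) →ₗ[LTCoeff F] PowerSeries (LTCoeff F) :=
  LinearMap.mulLeft (LTCoeff F) (PowerSeries.C (LTCoeff.of F (γ : 𝒪[F])) * evenPartTwo hπ hq (unitTwistSerTwo hπ (↑u⁻¹ : LTCoeff F) γ)) ∘ₗ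
      (PowerSeries.substAlgHom (PowerSeries.HasSubst.of_constantCoeff_zero'
        (constantCoeff_hom (isLTRing_LTCoeff hπ) (isLTSeries_LTCoeff π) (isLTSeries_LTCoeff π) (LTCoeff.of F (γ : 𝒪[F]))))).toLinearMap -
    LinearMap.id

/-- Unfolding `twistLinear`. [cite: deShalit1987, Ch. I §3.4 Lemma (ii)] -/
theorem twistLinear_apply (u : (LTCoeff F)ˣ) (γ : 𝒪[F]ˣ) (r : PowerSeries (LTCoeff F)) :
    twistLinear hπ hq u γ r = PowerSeries.C (LTCoeff.of F (γ : 𝒪[F])) * evenPartTwo hπ hq (unitTwistSerTwo hπ (↑u⁻¹ : LTCoeff F) γ) *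
      PowerSeries.subst (hom (isLTRing_LTCoeff hπ) (isLTSeries_LTCoeff π) (isLTSeries_LTCoeff π) (LTCoeff.of F (γ : 𝒪[F]))) r - r := by
  rw [twistLinear, LinearMap.sub_apply, LinearMap.comp_apply, LinearMap.id_apply, AlgHom.toLinearMap_apply, PowerSeries.coe_substAlgHom,
    LinearMap.mulLeft_apply]

/-- **`D_γ` is topologically nilpotent**: `D_γ(I_N) ⊆ I_{N+1}` (`twistOp_sub_self_mem_adicFilt_succ`). [cite: deShalit1987, Ch. I §3.1] -/
theorem twistLinear_mem_adicFiltGen_succ (u : (LTCoeff F)ˣ) (hu : LTCoeff.of F π = residueFieldCard F * u) (γ : 𝒪[F]ˣ) (N : ℕ)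
    (r : PowerSeries (LTCoeff F)) (hr : r ∈ adicFiltGen (LTCoeff.of F π) N) :
    twistLinear hπ hq u γ r ∈ adicFiltGen (LTCoeff.of F π) (N + 1) := by
  rw [twistLinear_apply]
  exact twistOp_sub_self_mem_adicFilt_succ hπ hq u hu γ hr

/-- `D_γ r_β = r_{σ_γ β} − r_β`. [cite: deShalit1987, Ch. I §3.4 Lemma (ii)] -/
theorem twistLinear_unitCoordTwo (u : (LTCoeff F)ˣ) (hu : LTCoeff.of F π = residueFieldCard F * u) (γ : 𝒪[F]ˣ) (β : NormCoherentUnits hπ) :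
    twistLinear hπ hq u γ (unitCoordTwo hπ hq u β) = unitCoordTwo hπ hq u (β.unitAct γ) - unitCoordTwo hπ hq u β := by
  rw [twistLinear_apply, unitCoordTwo_unitAct hπ hq u hu γ β]

/-! ### `r_{σ_γ β} = (1 + T)·r_β` and its powers -/

/-- ★★ **`r_{σ_γ β} = (1 + T)·r_β`** for the `𝒪_F⟦T⟧`-action `T = D_γ` on `𝒪_F⟦Y⟧` (`tAct`). [cite: deShalit1987, Ch. I §3.1, §3.4 Lemma (ii)] -/
theorem unitCoordTwo_unitAct_eq_tAct (u : (LTCoeff F)ˣ) (hu : LTCoeff.of F π = residueFieldCard F * u) (γ : 𝒪[F]ˣ) (β : NormCoherentUnits hπ) :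
    haveI := isAdicComplete_LTCoeff hπ
    unitCoordTwo hπ hq u (β.unitAct γ) =
      tAct (twistLinear hπ hq u γ) (twistLinear_mem_adicFiltGen_succ hπ hq u hu γ) (1 + PowerSeries.X) (unitCoordTwo hπ hq u β) := by
  haveI := isAdicComplete_LTCoeff hπ
  rw [tAct_add_left, tAct_one, tAct_X, twistLinear_unitCoordTwo hπ hq u hu, add_sub_cancel]

/-- ★★ **`r_{σ_{γ^n} β} = (1 + T)^n·r_β`**: the coordinates intertwine the action of `⟨γ⟩ ⊆ 𝒪_F^× ≅ Gal(K_π^∞/F)` on `𝒰` with the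
`𝒪_F⟦T⟧`-module structure `T = σ_γ − 1` on `𝒪_F⟦Y⟧` — de Shalit's `u^α ↦ (1+S)^α` on the series side, for the height-one Lubin–Tate tower
over `F` with `|𝓀_F| = 2`. [cite: deShalit1987, Ch. I §3.1, §3.4 Lemma (ii)] -/
theorem unitCoordTwo_unitAct_pow_eq_tAct (u : (LTCoeff F)ˣ) (hu : LTCoeff.of F π = residueFieldCard F * u) (γ : 𝒪[F]ˣ)
    (β : NormCoherentUnits hπ) (n : ℕ) :
    haveI := isAdicComplete_LTCoeff hπ
    unitCoordTwo hπ hq u (β.unitAct (γ ^ n)) =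
      tAct (twistLinear hπ hq u γ) (twistLinear_mem_adicFiltGen_succ hπ hq u hu γ) ((1 + PowerSeries.X) ^ n) (unitCoordTwo hπ hq u β) := by
  haveI := isAdicComplete_LTCoeff hπ
  induction n with
  | zero => rw [pow_zero, NormCoherentUnits.unitAct_one, pow_zero, tAct_one]
  | succ n ih =>
    rw [pow_succ', NormCoherentUnits.unitAct_mul, unitCoordTwo_unitAct_eq_tAct hπ hq u hu γ, ih, ← tAct_mul, ← pow_succ']

/-! ### The twist on monomials -/

/-- **`D_γ(Y^k) = γ·ρ_γ·[γ]_f^k − Y^k`**: the twist operator on the monomial basis of the coordinate module (`Y^k ∘ [γ] = [γ]^k`); for `k = 0`,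
`D_γ(1) = γ·ρ_γ − 1`. [cite: deShalit1987, Ch. I §3.4 Lemma (ii)] -/
theorem twistLinear_X_pow (u : (LTCoeff F)ˣ) (γ : 𝒪[F]ˣ) (k : ℕ) :
    twistLinear hπ hq u γ (PowerSeries.X ^ k) =
      PowerSeries.C (LTCoeff.of F (γ : 𝒪[F])) * evenPartTwo hπ hq (unitTwistSerTwo hπ (↑u⁻¹ : LTCoeff F) γ) *
        hom (isLTRing_LTCoeff hπ) (isLTSeries_LTCoeff π) (isLTSeries_LTCoeff π) (LTCoeff.of F (γ : 𝒪[F])) ^ k - PowerSeries.X ^ k := by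
  have hs : PowerSeries.HasSubst (hom (isLTRing_LTCoeff hπ) (isLTSeries_LTCoeff π) (isLTSeries_LTCoeff π) (LTCoeff.of F (γ : 𝒪[F]))) :=
    PowerSeries.HasSubst.of_constantCoeff_zero' (constantCoeff_hom _ _ _ _)
  rw [twistLinear_apply, PowerSeries.subst_pow hs, PowerSeries.subst_X hs]

/-- **`D_γ(1) = γ·ρ_γ − 1`**. [cite: deShalit1987, Ch. I §3.4 Lemma (ii)] -/
theorem twistLinear_one_right (u : (LTCoeff F)ˣ) (γ : 𝒪[F]ˣ) :
    twistLinear hπ hq u γ 1 = PowerSeries.C (LTCoeff.of F (γ : 𝒪[F])) * evenPartTwo hπ hq (unitTwistSerTwo hπ (↑u⁻¹ : LTCoeff F) γ) - 1 := by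
  have h := twistLinear_X_pow hπ hq u γ 0
  rw [pow_zero, pow_zero, mul_one] at h
  exact h

end CoordIwasawaActionTwo

end Literature.NumberTheory.GaloisRepresentations
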